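import Summits.BirchSwinnertonDyer.BirchSwinnertonDyer.Theorems.Rank2ShaTierBook
import Summits.BirchSwinnertonDyer.BirchSwinnertonDyer.Theorems.Rank2ObservatoryKernelCerts1707
import HarnessLib

/-!
# BirchSwinnertonDyer — rank-2 `Ш[p^∞]` cell: census tier `G2S30B`, file 000 — 1 booked rows (55696g1_23 … 55696g1_23)

HONEST FRAMING (cell `b2b-bsdr2sha`): per-pair CONDITIONAL theorems «named published facts (PRS = BMS16 Thm. 1.7,
Kato04 Thm. 17.4 [/ SU14 Thm. 3.6.9]) ∧ newform ∧ certified L-datum ∧ certified height datum ⇒ `Ш(E/ℚ)[p^∞]` finite of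
order `p^k`» for rank-2 curves at good ordinary `p ≥ 5`; NO claim on BSD in rank `≥ 2`; nothing is asserted or minted.
Every curve-side hypothesis (good ordinary, minimal model, image of `ρ̄`, (ram), Tamagawa / torsion arithmetic,
`2 ≤ rank_ℤ E(ℚ)`) is decided IN THE KERNEL (`decide +kernel` on the row literal; the observatory rank certificate).
Frames in this file: kato-bound × 1. Machine-written by lean-p2/gen/gen_sharow.py (P2) from file slice30b.assembled.jsonl (sha256 90e64e0cecd025549fd4689dbe06328bbbc79fb2e9cc5b18963bdc7efa461c83); filters: include=- exclude=- (1 → 1 rows);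
each row is a KERNEL CERTIFICATE theorem `checkK/checkSU/check = true [∧ k ≤ 0] ∧ 2 ≤ rank_ℤ E(ℚ)`; the readers
`ShaRow.booked_katoOne / booked_katoOneSU / booked_katoLe / booked_su / booked_finite` (Rank2ShaTierBook.lean) give the
`Ш`-statement, whose only binders are the named facts (PRS, Kato / SU), the newform, the L-datum and the height datum.
-/

set_option linter.dupNamespace false

namespace Summit.BirchSwinnertonDyer.BirchSwinnertonDyer.Rank2Sha.Census

/-- `55696g1` @ `p = 23` (V-BOUND 0): row certificate `checkK ∧ k ≤ 0 ∧ 2 ≤ rank` (Serre ℓ = (5,3,3), `#Ẽ(𝔽_23) = 18`, `∏c_ℓ = 2`, rank cert `KernelCerts1707.C55696g1.two_le_rank`); `ShaRow.booked_katoOne` gives `#Ш(E/ℚ)[23^∞] = 1` given PRS, Kato 17.4, the newform, `ord_23[T²]L_23 = 2`, canonical `ord_23 Reg_23 = 4`. [cite: SteinWuthrich2013, Alg. 11.1 and Prop. 11.2] -/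
theorem sha_55696g1_23 : let R : ShaRow := ⟨"55696g1", 0, 1, 0, -216, 1156, 4, 23, 4, 6, ⟨0, 0, 0, 0, 0, 0⟩, ⟨5, 2, 7, 2, 3, 1, 6, 3, 1, 6, 9⟩, [⟨2, 1, 5, 0, 2, 1, 8, 10, 72, 0, 2⟩, ⟨59, 7, 4, 0, 39, 0, 0, 2, 2, 1, 1⟩], [], [⟨2, 8, 2, 1, 8, 10, 0, 0⟩], 2, 4⟩; R.checkK = true ∧ R.k ≤ 0 ∧ 2 ≤ (R.e.baseChange ℚ).mordellWeilRank := ⟨by decide +kernel, by decide +kernel, Summit.BirchSwinnertonDyer.BirchSwinnertonDyer.Rank2Observatory.KernelCerts1707.C55696g1.two_le_rank⟩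

end Summit.BirchSwinnertonDyer.BirchSwinnertonDyer.Rank2Sha.Census
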